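import Summits.NavierStokesRegularity.NavierStokesRegularity.Theorems.SoloSalvageWu2026TangentSobolev
import Mathlib.MeasureTheory.Function.L2Space
import HarnessLib

/-!
# C177 `Wu2026` — Prop 3.3 (part 7): the pressure gradient `∇P = −(V·∇)V` of the Euler tangent

D-0090 NS-CLAIMS sweep, claim C177 (W. Wu, arXiv:2608.22471v1), skeleton
`Literature/Claims/NS/Wu2026.lean`; kernel objects for the binder `hP33` of `claim_of_steps''`
(Proposition 3.3 p.20). Printed step (p.20 l.40–55, (3.51)–(3.53)): «the Euler system (3.51)
div(V ⊗ V) + ∇P = 0, div V = 0 … gives ∇P = −(V·∇)V ∈ L^{9/7}_loc, so Q = P + |V|²/2 ∈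
W^{1,9/7}(U) with ∇Q = (∇V)ᵀV − (V·∇)V = V × curl V (Lamb's form (3.52))». In the kernel the
cross-product form is replaced by the equivalent antisymmetric form
`∇Q·w = ⟪V, ∂_w V⟫ − ⟪(V·∇)V, w⟫`, whose pairing with `w = V` vanishes identically. This file:

* `divergence_smul_const`, `inner_gradient_eq_fderiv`: calculus bookkeeping for the test fields
  `Φ = φ w` (constant `w`) fed to `Tangent.euler`, and for `⟪W, ∇φ⟫ = Dφ(W)`;
* `Tangent.euler_smul_const` — (3.51) tested with `φ w`: `∫ (∇φ·V)⟪V, w⟫ + P ∂_wφ = 0`;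
  `Tangent.divFree_fderiv` — `∫ ∇ψ·V = 0`;
* `hasWeakFDerivOn_pressure` — on an open `O` carrying the integrability of the tangent, the
  pressure has the weak derivative `w ↦ −⟪(DV)(V), w⟫` (Euler identity + the transport identity
  of part 3 applied to `u = ⟪w, V⟫`);
* `memLp_innerSL_comp`, `memLp_neg_innerSL_apply` — the two halves of `∇Q` are in `L^{9/7}`
  (Hölder `2/9 + 5/9 = 7/9`).

Seat ns-in-wu-p33 (cell pub/ns-inputs, D-0154 (2) INPUTS). WHAT THIS IS NOT: not a claim about
NS regularity or blow-up; no summit statement is proved here; records, not a verdict on the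
preprint.
-/

noncomputable section

set_option linter.dupNamespace false

open MeasureTheory TopologicalSpace Set Function Filter Topology Metric
open scoped ENNReal NNReal Topology ContDiff RealInnerProductSpace

namespace Summit.NavierStokesRegularity.NavierStokesRegularity.Theorems.Wu2026Salvage

open Literature.Analysis.FluidPDE Literature.Analysis.FunctionSpaces Literature.Claims.NS.Wu2026

/-! ### Calculus bookkeeping -/

/-- `div(φ w) = ∂_w φ` for a scalar `φ` and a constant vector `w`. [folklore] -/
theorem divergence_smul_const {φ : E3 → ℝ} (hφ : Differentiable ℝ φ) (w : E3) (y : E3) :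
    VectorCalculus.divergence (fun y => φ y • w) y = fderiv ℝ φ y w := by
  set b := stdOrthonormalBasis ℝ E3
  rw [divergence_eq_sum_inner_fderiv b, fderiv_smul_const (hφ y) w]
  simp only [ContinuousLinearMap.smulRight_apply, real_inner_smul_right]
  calc ∑ i, fderiv ℝ φ y (b i) * ⟪b i, w⟫ = fderiv ℝ φ y (∑ i, ⟪b i, w⟫ • b i) := by
        rw [map_sum]; simp only [map_smul, smul_eq_mul, mul_comm]
    _ = fderiv ℝ φ y w := by rw [b.sum_repr' w]

/-- `⟪W, ∇φ(y)⟫ = Dφ(y) W`. [folklore] -/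
theorem inner_gradient_eq_fderiv (φ : E3 → ℝ) (W y : E3) :
    ⟪W, gradient φ y⟫ = fderiv ℝ φ y W := by
  rw [real_inner_comm, gradient, InnerProductSpace.toDual_symm_apply]

section TangentFields

variable {ν : ℝ} {v : E3 → E3} {p : E3 → ℝ}

/-- **(3.51) tested with `Φ = φ w`**: for `φ ∈ C_c^∞(ℝ³ ∖ {0})` and a constant vector `w`,
`∫ (∇φ·V) ⟪V, w⟫ + P ∂_w φ = 0` («div(V ⊗ V) + ∇P = 0 in D′(R³ ∖ {0}; R³)», p.18 l.1–6).
[cite: Wu2026, (3.51) p.18 l.1–6] -/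
theorem Tangent.euler_smul_const (T : Tangent ν v p) {φ : E3 → ℝ} (hφ : ContDiff ℝ ∞ φ)
    (hφc : HasCompactSupport φ) (hφU : tsupport φ ⊆ (punctured : Set E3)) (w : E3) :
    ∫ y, (fderiv ℝ φ y (T.V y) * ⟪T.V y, w⟫ + T.P y * fderiv ℝ φ y w) = 0 := by
  have hΦ : IsTestVec punctured (fun y => φ y • w) :=
    ⟨hφ.smul contDiff_const, hφc.smul_right (f' := fun _ => w),
      (tsupport_smul_subset_left φ fun _ => w).trans hφU⟩
  have h := T.euler _ hΦ
  have hd : Differentiable ℝ φ := hφ.differentiable (by simp)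
  refine Eq.trans (integral_congr_ae (Eventually.of_forall fun y => ?_)) h
  simp only [fderiv_smul_const (hd y) w, ContinuousLinearMap.smulRight_apply,
    real_inner_smul_right, divergence_smul_const hd w y]

/-- **`div V = 0` in `D'(ℝ³ ∖ {0})`** in the form `∫ ∇ψ·V = 0`. [cite: Wu2026, (3.51) p.18 l.1 (div V = 0)] -/
theorem Tangent.divFree_fderiv (T : Tangent ν v p) {ψ : E3 → ℝ} (hψ : ContDiff ℝ ∞ ψ)
    (hψc : HasCompactSupport ψ) (hψU : tsupport ψ ⊆ (punctured : Set E3)) :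
    ∫ y, fderiv ℝ ψ y (T.V y) = 0 := by
  have h := T.divFree ψ ⟨hψ, hψc, hψU⟩
  simp_rw [inner_gradient_eq_fderiv] at h
  exact h

end TangentFields

/-! ### The two halves of `∇Q` are in `L^{9/7}` -/

section Halves

variable {O : Set E3} {V : E3 → E3} {gV : E3 → E3 →L[ℝ] E3}

/-- `y ↦ ⟪V, DV(y)·⟫ ∈ L^{9/7}` from `V ∈ L^{9/2}`, `DV ∈ L^{9/5}` («2/9 + 5/9 = 7/9»,
p.20 l.45–50). [cite: Wu2026, Prop 3.3 proof p.20 l.45–50] -/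
theorem memLp_innerSL_comp (hV : MemLp V ((9 : ℝ≥0∞) / 2) (volume.restrict O))
    (hgV : MemLp gV ((9 : ℝ≥0∞) / 5) (volume.restrict O)) :
    MemLp (fun y => (innerSL ℝ (V y)).comp (gV y)) ((9 : ℝ≥0∞) / 7) (volume.restrict O) := by
  haveI := holderTriple_nineHalves_nineFifths
  have hm : AEStronglyMeasurable (fun y => (innerSL ℝ (V y)).comp (gV y)) (volume.restrict O) :=
    (isBoundedBilinearMap_comp (𝕜 := ℝ) (E := E3) (F := E3) (G := ℝ)).continuous
      |>.comp_aestronglyMeasurable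
        (((innerSL ℝ (E := E3)).continuous.comp_aestronglyMeasurable hV.1).prodMk hgV.1)
  refine ⟨hm, ?_⟩
  have h := eLpNorm_le_eLpNorm_mul_eLpNorm_of_nnnorm (μ := volume.restrict O) hV.1 hgV.1
    (fun (u : E3) (M : E3 →L[ℝ] E3) => (innerSL ℝ u).comp M) 1
    (Eventually.of_forall fun y => by
      rw [one_mul, ← NNReal.coe_le_coe, coe_nnnorm, NNReal.coe_mul, coe_nnnorm, coe_nnnorm]
      exact (ContinuousLinearMap.opNorm_comp_le _ _).trans (by rw [innerSL_apply_norm]))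
    (p := (9 : ℝ≥0∞) / 2) (q := (9 : ℝ≥0∞) / 5) (r := (9 : ℝ≥0∞) / 7)
  refine lt_of_le_of_lt h ?_
  rw [ENNReal.coe_one, one_mul]
  exact ENNReal.mul_lt_top hV.eLpNorm_lt_top hgV.eLpNorm_lt_top

/-- `y ↦ −⟪(DV)(V), ·⟫ = −(V·∇)V ∈ L^{9/7}` from `V ∈ L^{9/2}`, `DV ∈ L^{9/5}`
(p.20 l.45–50). [cite: Wu2026, Prop 3.3 proof p.20 l.45–50] -/
theorem memLp_neg_innerSL_apply (hV : MemLp V ((9 : ℝ≥0∞) / 2) (volume.restrict O))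
    (hgV : MemLp gV ((9 : ℝ≥0∞) / 5) (volume.restrict O)) :
    MemLp (fun y => -(innerSL ℝ (gV y (V y)))) ((9 : ℝ≥0∞) / 7) (volume.restrict O) := by
  haveI := holderTriple_nineHalves_nineFifths
  have hm : AEStronglyMeasurable (fun y => -(innerSL ℝ (gV y (V y)))) (volume.restrict O) :=
    ((innerSL ℝ (E := E3)).continuous.comp_aestronglyMeasurable
      (aestronglyMeasurable_clm_apply hgV.1 hV.1)).neg
  refine ⟨hm, ?_⟩
  have h := eLpNorm_le_eLpNorm_mul_eLpNorm_of_nnnorm (μ := volume.restrict O) hV.1 hgV.1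
    (fun (u : E3) (M : E3 →L[ℝ] E3) => -(innerSL ℝ (M u))) 1
    (Eventually.of_forall fun y => by
      rw [one_mul, ← NNReal.coe_le_coe, coe_nnnorm, NNReal.coe_mul, coe_nnnorm, coe_nnnorm,
        norm_neg, innerSL_apply_norm, mul_comm]
      exact (gV y).le_opNorm _)
    (p := (9 : ℝ≥0∞) / 2) (q := (9 : ℝ≥0∞) / 5) (r := (9 : ℝ≥0∞) / 7)
  refine lt_of_le_of_lt h ?_
  rw [ENNReal.coe_one, one_mul]
  exact ENNReal.mul_lt_top hV.eLpNorm_lt_top hgV.eLpNorm_lt_top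

end Halves

/-! ### The weak pressure gradient -/

/-- **`∇P = −(V·∇)V` weakly** (p.20 l.40–50: from (3.51) `div(V ⊗ V) + ∇P = 0`, `div V = 0`
and the product rule). Abstract form: on an open set `O` of finite measure, let `V ∈ L^{9/2}(O)`
have the weak derivative `DV ∈ L^{9/5}(O)`, `P ∈ L^{3/2}(O)`, let `div V = 0` weakly and let the
Euler identity `∫ (∇φ·V)⟪V, w⟫ + P ∂_wφ = 0` hold for test functions on `O`. Then `P` has the
weak derivative `w ↦ −⟪DV(V), w⟫` on `O`: the transport identity
(`integral_mul_fderiv_apply_eq_of_divFree`) gives `∫ ⟪w, V⟫ ∇φ·V = −∫ φ ⟪w, DV(V)⟫`.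
[cite: Wu2026, Prop 3.3 proof p.20 l.40–50] -/
theorem hasWeakFDerivOn_pressure {O : Opens E3} [IsFiniteMeasure (volume.restrict (O : Set E3))]
    {V : E3 → E3} {gV : E3 → E3 →L[ℝ] E3} {P : E3 → ℝ}
    (hVw : HasWeakFDerivOn O volume V gV) (hV : MemLp V ((9 : ℝ≥0∞) / 2) (volume.restrict O))
    (hgV : MemLp gV ((9 : ℝ≥0∞) / 5) (volume.restrict O))
    (hP : MemLp P ((3 : ℝ≥0∞) / 2) (volume.restrict O))
    (hdiv : ∀ ψ : E3 → ℝ, ContDiff ℝ ∞ ψ → HasCompactSupport ψ → tsupport ψ ⊆ (O : Set E3) →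
      ∫ x, fderiv ℝ ψ x (V x) = 0)
    (heuler : ∀ φ : E3 → ℝ, ContDiff ℝ ∞ φ → HasCompactSupport φ → tsupport φ ⊆ (O : Set E3) →
      ∀ w : E3, ∫ y, (fderiv ℝ φ y (V y) * ⟪V y, w⟫ + P y * fderiv ℝ φ y w) = 0) :
    HasWeakFDerivOn O volume P (fun y => -(innerSL ℝ (gV y (V y)))) := by
  haveI := holderTriple_nineHalves_nineSevenths
  have h97le95 : (9 : ℝ≥0∞) / 7 ≤ 9 / 5 := ENNReal.div_le_div_left (by norm_num) _
  have h97le92 : (9 : ℝ≥0∞) / 7 ≤ 9 / 2 := ENNReal.div_le_div_left (by norm_num) _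
  have h1le32 : (1 : ℝ≥0∞) ≤ 3 / 2 := by
    rw [ENNReal.le_div_iff_mul_le (by norm_num) (by norm_num)]; norm_num
  have h1le92 : (1 : ℝ≥0∞) ≤ 9 / 2 := by
    rw [ENNReal.le_div_iff_mul_le (by norm_num) (by norm_num)]; norm_num
  have h92top : (9 : ℝ≥0∞) / 2 ≠ ⊤ := ENNReal.div_ne_top (by norm_num) (by norm_num)
  have h97top : (9 : ℝ≥0∞) / 7 ≠ ⊤ := ENNReal.div_ne_top (by norm_num) (by norm_num)
  have h1le97 : (1 : ℝ≥0∞) ≤ 9 / 7 := by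
    rw [ENNReal.le_div_iff_mul_le (by norm_num) (by norm_num)]; norm_num
  have hgV97 : MemLp gV ((9 : ℝ≥0∞) / 7) (volume.restrict O) := hgV.mono_exponent h97le95
  have hV97 : MemLp V ((9 : ℝ≥0∞) / 7) (volume.restrict O) := hV.mono_exponent h97le92
  have hgP := memLp_neg_innerSL_apply hV hgV
  refine ⟨IntegrableOn.locallyIntegrableOn (hP.integrable h1le32),
    IntegrableOn.locallyIntegrableOn (hgP.integrable h1le97), fun φ w hφ => ?_⟩
  obtain ⟨hφs, hφc, hφO⟩ := hφ
  have hDφc : Continuous (fderiv ℝ φ) := hφs.continuous_fderiv (by simp)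
  obtain ⟨CDφ, hCDφ⟩ := hDφc.bounded_above_of_compact_support (hφc.fderiv ℝ)
  have hCDφ0 : 0 ≤ CDφ := (norm_nonneg _).trans (hCDφ 0)
  have hVm : AEStronglyMeasurable V (volume.restrict O) := hV.1
  -- the transport identity for `u = ⟪w, V⟫`
  have hu : HasWeakFDerivOn O volume (fun y => (innerSL ℝ w) (V y))
      (fun y => (innerSL ℝ w).comp (gV y)) := hasWeakFDerivOn_clm_apply' hVw (innerSL ℝ w)
  have hup : MemLp (fun y => (innerSL ℝ w) (V y)) ((9 : ℝ≥0∞) / 2) (volume.restrict O) := by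
    simpa only [innerSL_apply_apply] using hV.const_inner w
  have hguq : MemLp (fun y => (innerSL ℝ w).comp (gV y)) ((9 : ℝ≥0∞) / 7)
      (volume.restrict O) := by
    have := (ContinuousLinearMap.compL ℝ E3 E3 ℝ (innerSL ℝ w)).comp_memLp' hgV97
    simpa [Function.comp_def] using this
  have htr := integral_mul_fderiv_apply_eq_of_divFree (p := (9 : ℝ≥0∞) / 2) (p' := 9 / 7)
    (q := (9 : ℝ≥0∞) / 7) (q' := 9 / 2) h1le92 h92top h1le97 h97top hu hup hguq hV97 hV hdiv
    hφs hφc hφO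
  simp only [innerSL_apply_apply, ContinuousLinearMap.comp_apply] at htr
  -- the Euler identity, split into its two (integrable) summands on `O`
  have hE := heuler φ hφs hφc hφO w
  have hout : ∀ x, x ∉ (O : Set E3) → x ∉ tsupport φ := fun x hx hx' => hx (hφO hx')
  have hφ0 : ∀ x, x ∉ (O : Set E3) → φ x = 0 := fun x hx =>
    image_eq_zero_of_notMem_tsupport (hout x hx)
  have hDφ0 : ∀ x, x ∉ (O : Set E3) → fderiv ℝ φ x = 0 := fun x hx =>
    fderiv_of_notMem_tsupport ℝ (hout x hx)
  have hI1 : Integrable (fun y => fderiv ℝ φ y (V y) * ⟪V y, w⟫) (volume.restrict O) :=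
    integrable_of_norm_le_mul (p := (9 : ℝ≥0∞) / 2) (q := 9 / 7) (C := CDφ * ‖w‖)
      ((aestronglyMeasurable_clm_apply hDφc.aestronglyMeasurable hVm).mul
        (hVm.inner aestronglyMeasurable_const)) hV hV97 fun y => by
      rw [norm_mul]
      calc ‖fderiv ℝ φ y (V y)‖ * ‖⟪V y, w⟫‖ ≤ (CDφ * ‖V y‖) * (‖V y‖ * ‖w‖) :=
            mul_le_mul (((fderiv ℝ φ y).le_opNorm _).trans
              (mul_le_mul_of_nonneg_right (hCDφ y) (norm_nonneg _))) (norm_inner_le_norm _ _)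
              (norm_nonneg _) (by positivity)
        _ = CDφ * ‖w‖ * (‖V y‖ * ‖V y‖) := by ring
  have hI2 : Integrable (fun y => P y * fderiv ℝ φ y w) (volume.restrict O) := by
    have h := (hP.integrable h1le32).bdd_mul (hDφc.clm_apply continuous_const).aestronglyMeasurable
      (c := CDφ * ‖w‖) (Eventually.of_forall fun y =>
        ((fderiv ℝ φ y).le_opNorm w).trans (mul_le_mul_of_nonneg_right (hCDφ y) (norm_nonneg _)))
    simpa only [mul_comm] using h
  rw [← setIntegral_eq_integral_of_forall_compl_eq_zero (s := (O : Set E3)) (fun x hx => by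
      simp only [hDφ0 x hx, zero_apply, zero_mul, mul_zero, add_zero]), integral_add hI1 hI2] at hE
  rw [← setIntegral_eq_integral_of_forall_compl_eq_zero (s := (O : Set E3)) (fun x hx => by
      simp only [hDφ0 x hx, zero_apply, mul_zero]),
    ← setIntegral_eq_integral_of_forall_compl_eq_zero (s := (O : Set E3))
      (f := fun x => φ x * ⟪w, gV x (V x)⟫) (fun x hx => by simp only [hφ0 x hx, zero_mul])] at htr
  have e1 : ∫ x in (O : Set E3), fderiv ℝ φ x (V x) * ⟪V x, w⟫ =
      ∫ x in (O : Set E3), ⟪w, V x⟫ * fderiv ℝ φ x (V x) :=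
    integral_congr_ae (Eventually.of_forall fun x => by
      show fderiv ℝ φ x (V x) * ⟪V x, w⟫ = ⟪w, V x⟫ * fderiv ℝ φ x (V x)
      rw [mul_comm, real_inner_comm])
  have e2 : (fun x => (fderiv ℝ φ x w) • P x) = fun x => P x * fderiv ℝ φ x w := by
    funext x; rw [smul_eq_mul, mul_comm]
  have e3 : (fun x => φ x • (-(innerSL ℝ (gV x (V x)))) w) = fun x => -(φ x * ⟪w, gV x (V x)⟫) := by
    funext x; rw [neg_apply, innerSL_apply_apply, smul_eq_mul, real_inner_comm, mul_neg]
  rw [e2, e3, integral_neg, neg_neg]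
  linarith [hE, htr, e1]

end Summit.NavierStokesRegularity.NavierStokesRegularity.Theorems.Wu2026Salvage
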